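import Mathlib
import Literature.MathematicalPhysics.KineticTheory.FouriersLaw
import Literature.MathematicalPhysics.KineticTheory.LangevinChainKernel
import Literature.MathematicalPhysics.KineticTheory.LangevinChainGibbs

/-!
# Sketch — crux `JunctionLocality.ConductanceLowerBound` (stmt-AtomisticToContinuum-11749), ideator k = 1

First lemmas of the two crux-idea cards (they only need to ELABORATE; nothing here is filed):

* card A `far-contact-fisher-square`: `FarContactFisherSquare` — the exact identity
  `∫₀^∞ Cov_μ(p_0²(0), p_{N-1}²(t)) dt = 2γT · ‖∂_{p_{N-1}} φ_N‖²_{L²(μ_N)}` for the equilibrium open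
  chain (`μ_N` = Gibbs at `T`, `φ_N := ∫₀^∞ P_t (p_0² − T) dt` the injection potential of the hot
  contact), and `ConditionalVarianceFloor` — the CLT-scale floor that, with the identity, the
  Kundu–Dhar–Narayan/escape identity `G_N = (γ²/T²)·∫₀^∞ Cov(p_0²(0),p_{N-1}²(t))dt` and the Gaussian
  Poincaré inequality in the single coordinate `p_{N-1}`, gives `D_N = (N-1) G_N ≥ c`.
* card B `cold-bath-relocation-walk`: `relocGenerator` (cold bath moved to an interior site `m`,
  sites `m+1 … N-1` a passive tail), `CoLocatedAnchor` (both baths on site `0` ⇒ every weak steady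
  state has `⟨p_0²⟩ = (T_L+T_R)/2`, i.e. conductance `γ/2` exactly, at every `N`) and the
  real-variable telescoping glue `telescope_of_bounded_increments`.
-/

noncomputable section

open MeasureTheory Filter Topology ProbabilityTheory
open scoped NNReal ENNReal

namespace Summit.AtomisticToContinuum.FouriersLaw.Cruxes.ConductanceLowerBound.Sketch

open Literature.MathematicalPhysics.KineticTheory.HeatConduction

/-! ### Card A — far-contact Fisher square -/

/-- The injection potential of the hot contact of the equilibrium open `N`-chain (both baths at
`T`): `φ_N(z) = ∫₀^∞ (E_z[p_0(t)²] − T) dt`, written with the constructed transition kernels. -/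
def injectionPotential (ω₂ lam β γ T : ℝ) (N : ℕ) (i₀ : Fin N) (z : PhaseSpace N) : ℝ :=
  ∫ t in Set.Ioi (0 : ℝ),
    ((∫ y, (y.2 i₀) ^ 2 ∂((pinnedChain ω₂ lam β γ).transitionKernel N T T t.toNNReal z)) - T)

/-- The equilibrium transmission integral `I_×(N) = ∫₀^∞ Cov_μ(p_0²(0), p_{N-1}²(t)) dt`
(`μ` = Gibbs at `T`; `E_μ[p_0² − T] = 0`, so the covariance is `E[(p_0²−T)(0)·p_{N-1}²(t)]`). By the
Kundu–Dhar–Narayan / escape-deficit identity the two-terminal linear-response conductance is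
`G_N = (γ²/T²)·I_×(N)` and `D_N = (N−1)·G_N`. -/
def transmissionIntegral (ω₂ lam β γ T : ℝ) (N : ℕ) (i₀ iN : Fin N) : ℝ :=
  ∫ t in Set.Ioi (0 : ℝ),
    ∫ z, ((z.2 i₀) ^ 2 - T) *
        (∫ y, (y.2 iN) ^ 2 ∂((pinnedChain ω₂ lam β γ).transitionKernel N T T t.toNNReal z))
      ∂((pinnedChain ω₂ lam β γ).gibbsMeasure N T)

/-- **First lemma of card A (exact identity, fixed `N`).** For the equilibrium open chain with
Langevin baths at both ends at temperature `T`, the transmission integral is a perfect square: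
`I_×(N) = 2γT · ∫ (∂_{p_{N-1}} φ_N)² dμ_N`. Proof sketch (four exact finite-`N` identities): Dirichlet
form `⟨f,−Lf⟩_μ = γT Σ_b ‖∂_{p_b}f‖²`; conservation `γ(φ^{(0)} + φ^{(N-1)}) = H − ⟨H⟩`; the projection
`⟨∂_{p_b}φ^{(0)}, p_b⟩ = ⟨φ^{(0)}, p_b² − T⟩/T`; left–right reflection symmetry of `pinnedChain`. -/
def FarContactFisherSquare : Prop :=
  ∀ ω₂ lam β γ : ℝ, 0 < ω₂ → 0 < lam → 0 < β → 0 < γ → ∀ T : ℝ, 0 < T →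
    ∀ N : ℕ, ∀ h2 : 2 ≤ N,
      let i₀ : Fin N := ⟨0, by omega⟩
      let iN : Fin N := ⟨N - 1, by omega⟩
      transmissionIntegral ω₂ lam β γ T N i₀ iN =
        2 * γ * T * ∫ z, (partialP iN (injectionPotential ω₂ lam β γ T N i₀) z) ^ 2
          ∂((pinnedChain ω₂ lam β γ).gibbsMeasure N T)

/-- **The crux in sensitivity form (card A's load-bearing statement).** CLT-scale floor for the
conditional variance of the injection potential in the far-contact momentum: resampling `p_{N-1}`
from its Maxwellian changes `φ_N` by an rms amount `≳ N^{-1/2}`: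
`(N−1) · E_μ[(φ_N(z) − E[φ_N | all coordinates but p_{N-1}](z))²] ≥ c > 0` for `N ≥ N₁`.
With `FarContactFisherSquare`, the Gaussian Poincaré inequality in the coordinate `p_{N-1}`
(`T·∫(∂_{p}f)² ≥ Var_p f`) and `G_N = (γ²/T²) I_×(N)` this gives `D_N = (N−1)G_N ≥ 2γ³c/T²`. -/
def ConditionalVarianceFloor : Prop :=
  ∀ ω₂ lam β γ : ℝ, 0 < ω₂ → 0 < lam → 0 < β → 0 < γ → ∀ T : ℝ, 0 < T →
    ∃ c : ℝ, 0 < c ∧ ∃ N₁ : ℕ, ∀ N : ℕ, ∀ h : N₁ + 2 ≤ N,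
      let i₀ : Fin N := ⟨0, by omega⟩
      let iN : Fin N := ⟨N - 1, by omega⟩
      let φ := injectionPotential ω₂ lam β γ T N i₀
      let φbar : PhaseSpace N → ℝ := fun z =>
        ∫ s, φ (z.1, Function.update z.2 iN s) ∂(gaussianReal 0 T.toNNReal)
      c ≤ ((N : ℝ) - 1) * ∫ z, (φ z - φbar z) ^ 2 ∂((pinnedChain ω₂ lam β γ).gibbsMeasure N T)

/-- The unconstrained Thomson (witness) form of the same floor: some test function `v_N` with
`‖v_N‖_{L²(μ)} ≤ 1` has end-to-end response
`|∫₀^∞ E_μ[(∂*_{p_{N-1}} v_N)(X_0) · (p_0² − T)(X_t)] dt| ≥ c·N^{-1/2}`, where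
`∂* v = −∂_{p_{N-1}} v + p_{N-1} v / T` is the `L²(μ)`-adjoint of `∂_{p_{N-1}}`. Since
`⟨φ_N, ∂* v⟩ = ⟨∂_{p_{N-1}} φ_N, v⟩`, Cauchy–Schwarz and `FarContactFisherSquare` give
`G_N ≥ (2γ³/T)·c²/N`. -/
def WitnessFloor : Prop :=
  ∀ ω₂ lam β γ : ℝ, 0 < ω₂ → 0 < lam → 0 < β → 0 < γ → ∀ T : ℝ, 0 < T →
    ∃ c : ℝ, 0 < c ∧ ∃ N₁ : ℕ, ∀ N : ℕ, ∀ h : N₁ + 2 ≤ N,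
      let i₀ : Fin N := ⟨0, by omega⟩
      let iN : Fin N := ⟨N - 1, by omega⟩
      let μ := (pinnedChain ω₂ lam β γ).gibbsMeasure N T
      ∃ v : PhaseSpace N → ℝ, (∫ z, (v z) ^ 2 ∂μ) ≤ 1 ∧
        c / Real.sqrt N ≤
          |∫ t in Set.Ioi (0 : ℝ),
              ∫ z, (-(partialP iN v z) + z.2 iN * v z / T) *
                  ((∫ y, (y.2 i₀) ^ 2 ∂((pinnedChain ω₂ lam β γ).transitionKernel N T T t.toNNReal z)) - T)
                ∂μ|

/-- **Algebraic core of `FarContactFisherSquare` (PROVED).** In any real inner-product space: if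
the hot potential's own-contact gradient is `g₀ = γ⁻¹ p₀ − g₀'` (conservation, `g₀'` = the cold
potential's gradient at the hot contact), `⟪g₀', p₀⟫ = I_×/T` (projection identity + time reversal),
`‖p₀‖² = T` (Maxwellian momentum), the Dirichlet identity `I = γT(‖g₀‖² + ‖g_m‖²)` holds and the
sum rule `I + I_× = T²/γ` holds, then the transmission integral is the perfect square
`I_× = γT(‖g₀'‖² + ‖g_m‖²)` (with reflection symmetry `‖g₀'‖ = ‖g_m‖` this is `2γT‖g_m‖²`). -/
theorem transmission_perfect_square {E : Type*} [NormedAddCommGroup E] [InnerProductSpace ℝ E]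
    (p₀ g₀ g₀' gm : E) (γ T I Ix : ℝ) (hγ : γ ≠ 0) (hT : T ≠ 0)
    (hcons : g₀ = γ⁻¹ • p₀ - g₀') (hproj : @inner ℝ E _ g₀' p₀ = Ix / T) (hp : ‖p₀‖ ^ 2 = T)
    (hDir : I = γ * T * (‖g₀‖ ^ 2 + ‖gm‖ ^ 2)) (hsum : I + Ix = T ^ 2 / γ) :
    Ix = γ * T * (‖g₀'‖ ^ 2 + ‖gm‖ ^ 2) := by
  have hexp : ‖g₀‖ ^ 2 = γ⁻¹ ^ 2 * T - 2 * γ⁻¹ * (Ix / T) + ‖g₀'‖ ^ 2 := by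
    rw [hcons, norm_sub_sq_real, norm_smul, mul_pow, Real.norm_eq_abs, sq_abs, hp, inner_smul_left,
      real_inner_comm, hproj]
    simp
    ring
  have hDir' : I = T ^ 2 / γ - 2 * Ix + γ * T * (‖g₀'‖ ^ 2 + ‖gm‖ ^ 2) := by
    rw [hDir, hexp]
    field_simp
    ring
  linarith [hDir', hsum]

/-! ### Card B — cold-bath relocation walk -/

/-- Generator of the `N`-chain with the hot Langevin bath on site `0` and the COLD bath moved to
site `m` (`m ≤ N-1`; sites `m+1, …, N-1` form a passive, unthermostatted tail hanging beyond the
cold contact; `m = N-1` is `OscillatorChain.generator`, `m = 0` puts both baths on site `0`). -/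
def relocGenerator (P : OscillatorChain) (N m : ℕ) (T_L T_R : ℝ) (f : PhaseSpace N → ℝ)
    (x : PhaseSpace N) : ℝ :=
  (∑ i, (x.2 i * partialQ i f x - partialQ i (P.hamiltonian N) x * partialP i f x)) +
    P.γ * ∑ i : Fin N,
      ((if i.val = 0 then T_L * partialP i (partialP i f) x - x.2 i * partialP i f x else 0) +
        (if i.val = m then T_R * partialP i (partialP i f) x - x.2 i * partialP i f x else 0))

/-- Weak steady states of the relocated chain (same class as `OscillatorChain.IsSteadyState`,
plus integrability of the hot-contact kinetic energy so that the heat current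
`J = γ(T_L − ∫ p_0² dμ)` is an honest expectation). -/
def IsRelocSteadyState (P : OscillatorChain) (N m : ℕ) (T_L T_R : ℝ) (μ : Measure (PhaseSpace N))
    (i₀ : Fin N) : Prop :=
  IsProbabilityMeasure μ ∧
    (∀ f : PhaseSpace N → ℝ, ContDiff ℝ (⊤ : ℕ∞) f → HasCompactSupport f →
      ∫ x, relocGenerator P N m T_L T_R f x ∂μ = 0) ∧
    Integrable (fun x => (x.2 i₀) ^ 2) μ ∧ Integrable (P.hamiltonian N) μ

/-- **First lemma of card B (the exact anchor of the walk).** With both baths on site `0`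
(`m = 0`) the heat current from the hot bath is `γ(T_L − T_R)/2` in EVERY weak steady state and
for every `N`: testing stationarity against (a truncation of) `H` gives
`0 = ∫ L H dμ = γ(T_L − ∫p_0²) + γ(T_R − ∫p_0²)`, i.e. `∫ p_0² dμ = (T_L + T_R)/2`; hence the
relocated conductance is `G(0) = γ/2` exactly, the anchor of the telescoping
`1/G_N = 2/γ + Σ_m [1/G(m+1) − 1/G(m)]`. -/
def CoLocatedAnchor : Prop :=
  ∀ ω₂ lam β γ : ℝ, 0 < ω₂ → 0 < lam → 0 < β → 0 < γ → ∀ (N : ℕ) (hN : 1 ≤ N) (T_L T_R : ℝ),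
    0 < T_L → 0 < T_R → ∀ μ : Measure (PhaseSpace N),
      IsRelocSteadyState (pinnedChain ω₂ lam β γ) N 0 T_L T_R μ ⟨0, by omega⟩ →
        ∫ x, (x.2 ⟨0, by omega⟩) ^ 2 ∂μ = (T_L + T_R) / 2

/-- **Card B's crux in typed form (`RelocationResistance`, the C⁺ of the Transfer field).** For the
relocated chains (hot bath on site `0` at `T + δ/2`, cold bath on site `m` at `T − δ/2`) and any
family of weak steady states indexed by the cold-bath position, the linear-response conductances
`G m := lim_{δ→0} γ(T + δ/2 − ∫ p_0² dμ_{m,δ})/δ` (heat drawn from the hot bath per unit bias) have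
BOUNDED ONE-SITE RELOCATION RESISTANCE: `1/G(m+1) − 1/G(m) ≤ C` uniformly in `N` and `m ≤ N − 2`.
(Uniqueness of the relocated steady states and existence of the limits are support-grade inputs, as
for the crux itself; with `CoLocatedAnchor` and `telescope_of_bounded_increments` this gives
`D_N = (N−1)·G(N−1) ≥ 1/(2/γ + C)`.) -/
def RelocationResistance : Prop :=
  ∀ ω₂ lam β γ : ℝ, 0 < ω₂ → 0 < lam → 0 < β → 0 < γ → ∀ T : ℝ, 0 < T →
    ∃ C : ℝ, ∀ (N m : ℕ) (h : m + 2 ≤ N),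
      let i₀ : Fin N := ⟨0, by omega⟩
      ∀ μ : ℕ → ℝ → ℝ → Measure (PhaseSpace N),
        (∀ (m' : ℕ) (T_L T_R : ℝ), 0 < T_L → 0 < T_R →
          IsRelocSteadyState (pinnedChain ω₂ lam β γ) N m' T_L T_R (μ m' T_L T_R) i₀) →
        ∀ G : ℕ → ℝ,
          (∀ m' : ℕ, Tendsto (fun δ : ℝ =>
              γ * (T + δ / 2 - ∫ x, (x.2 i₀) ^ 2 ∂(μ m' (T + δ / 2) (T - δ / 2))) / δ)
            (𝓝[≠] 0) (𝓝 (G m'))) →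
          0 < G m → 0 < G (m + 1) → 1 / G (m + 1) - 1 / G m ≤ C

/-- **Telescoping glue of card B (pure real analysis, provable now).** If the relocated
conductances satisfy the anchor `G 0 = γ/2`, stay positive, and have bounded relocation
resistance `1/G(m+1) − 1/G(m) ≤ C`, then `G n ≥ 1/(2/γ + C n)`, so
`D_N = (N−1)·G(N−1) ≥ (N−1)/(2/γ + C(N−1)) ≥ 1/(2/γ + C)` for `N ≥ 2`. -/
theorem telescope_of_bounded_increments (G : ℕ → ℝ) (γ C : ℝ) (hγ : 0 < γ) (hC : 0 ≤ C)
    (h0 : G 0 = γ / 2) (hpos : ∀ m, 0 < G m) (hinc : ∀ m, 1 / G (m + 1) - 1 / G m ≤ C) :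
    ∀ n : ℕ, 1 / (2 / γ + C * n) ≤ G n := by
  have key : ∀ n : ℕ, 1 / G n ≤ 2 / γ + C * n := by
    intro n
    induction n with
    | zero => simp [h0]
    | succ k ih =>
      have := hinc k
      push_cast
      linarith
  intro n
  have hGn := hpos n
  have hden : 0 < 2 / γ + C * n := by positivity
  exact (one_div_le hden hGn).mpr (key n)

end Summit.AtomisticToContinuum.FouriersLaw.Cruxes.ConductanceLowerBound.Sketch

end
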